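/-
Copyright (c) 2026. All rights reserved.
Released under Apache 2.0 license as described in the file LICENSE.
Authors: HodgeCM publication cell (pub-hodgecm), model-construction sub-cell, construction prover `mc-unitary-3`.
-/
import Literature.NumberTheory.Weil1964.AdelicMetaplecticGroup
import HarnessLib

/-!
# Complex conjugation on the adelic Schrödinger model: `ω_{−T} ≅ ω̄_T`

Topic `NumberTheory/Weil1964`; namespace `Literature.NumberTheory.Weil1964`.  KERNEL MATHEMATICS ONLY: no
`def … : Prop` record of a published theorem, no `axiom`, no proof hole; every tag is provenance for a kernel-checked
statement.  Origin: `pub-hodgecm` SEAMS sprint, site S4-10 kernel item (a) ("model of `−T` = complex-conjugate model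
of `T`"), the identification behind `θ̄_φ = θ_{φ̄}` on the space `W⁻ = (W, −⟨·,·⟩)` of the doubling method
([Li1992, p. 181]: "`ω*` is the contragredient representation of `ω`, and is the same as `ω_{ψ̄}`";
[MoeglinVignerasWaldspurger1987, Chap. 2 II.1]: transport of structure for `S̃p_ψ(W)`).

SETTING.  The tree's global Schrödinger representation `ρ_T = adelicSchrodinger F ι T` of the adelic Heisenberg group
`H(W_T) = Heisenberg (polar β_T)`, `β_T(x, y) = x ⬝ (T y)`, on `𝒮(𝔸_F^ι) = piSchwartzBruhat F ι`
(`AdelicHeisenbergSchrodinger.lean`): `(ρ_T((x,y),t)Φ)(u) = ψ_F(t + ⟨u, T y⟩) Φ(u + x)`; the group of implementing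
pairs `Mp_ψ(W_T) = adelicMp F ι T` with `π = MpPsi.proj`, `ω_ψ(g, M) = M` (`AdelicMetaplecticGroup.lean`).

WHAT IS HERE (all proved):
* §1 (generic) the isomorphism `(v, t) ↦ (v, −t) : Heisenberg B ≃* Heisenberg B′` when `B′ = −B`
  (`heisenbergNegCenter`), the equality of symplectic groups `Sp(alt B) = Sp(alt B′)` as an isomorphism that is the
  identity on `GL(V)` (`symplecticGroupNeg`), and their compatibility with Weil's section `g ↦ (g, f_g)`
  (`heisenbergNegCenter_act`); then TRANSPORT OF STRUCTURE for `MpPsi` along a SEMILINEAR operator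
  `A : S ≃ₛₗ[σ] S′` intertwining `ρ` with `ρ′ ∘ ν` for abstract isomorphisms `ν : Heisenberg B ≃* Heisenberg B′`,
  `e : Sp(B) ≃* Sp(B′)` compatible with the sections (`MpPsi.slTransport : MpPsi ρ ≃* MpPsi ρ′`,
  `(g, M) ↦ (e g, A M A⁻¹)`), with the formulas for `π`, `toOp`, `ω_ψ`, and preservation of `Θ`-fixing subgroups
  when `Θ′ ∘ A = τ ∘ Θ` for an injective `τ` (`MpPsi.slTransport_mem_fixing_iff`).  (The linear case `σ = id` of this
  transport with `ν = heisenbergCongr θ` is `AdelicMetaplecticTransport.lean` §1; here `A` may be conjugate-linear.)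
* §2 `𝒮(𝔸_F^ι)` IS CLOSED UNDER COMPLEX CONJUGATION (`star_mem_piSchwartzBruhat`: archimedean factor by Mathlib's
  `SchwartzMap.postcompCLM` of the real-linear `Complex.conjCLE`, finite factor locally constant of compact support),
  the conjugate-linear involution `piSchwartzBruhatConj F ι : 𝒮(𝔸_F^ι) ≃ₛₗ[conj] 𝒮(𝔸_F^ι)`, `Φ ↦ Φ̄`, and
  `Θ(Φ̄) = conj Θ(Φ)` for the theta distribution (`thetaDist_star`).
* §3 THE CONJUGATE MODEL: `conj (ρ_T(h) Φ) = ρ_{−T}(ν h) Φ̄` with `ν (w, t) = (w, −t)` (`adelicSchrodinger_conj`,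
  from `conj ψ_F(a) = ψ_F(−a)`); hence **`adelicMpConj F ι T : Mp_ψ(W_T) ≃* Mp_ψ(W_{−T})`, `(g, M) ↦ (g, C M C)`**,
  covering the IDENTITY of `Sp(W_T)(𝔸) = Sp(W_{−T})(𝔸) ≤ GL(W_𝔸)` (`coe_proj_adelicMpConj`), with
  **`ω_{−T}(pᶜ) Ψ = conj (ω_T(p) Ψ̄)`** (`toOp_adelicMpConj_apply`) — the Weil representation of the space with the
  negated form is the complex conjugate of the Weil representation — preservation of the `Θ`-fixing subgroups
  `Mp_ψ(W)^Θ` (`adelicMpConj_mem_adelicMpTheta_iff`) and the THETA-KERNEL CONJUGATION FORMULA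
  `Θ(ω_{−T}(pᶜ) Φ̄) = conj Θ(ω_T(p) Φ)` (`thetaDist_toOp_adelicMpConj`): the conjugate of the theta kernel of `Φ`
  is the theta kernel of `Φ̄` in the model of `W⁻`.

WHAT IS NOT HERE: the restriction to the group of record `Mp_ψ(W_𝔸)ᶜᵒⁿᵗ` (LF-continuity of `C M C`;
`AdelicMetaplecticContinuous.lean` states `IsLFContinuous` for `ℂ`-linear maps — a separate leaf); the evaluation
`δ(φ ⊗ φ̄)(0) = ⟨φ, φ⟩` of the change of polarisation ([Li1992, (12)–(13) p. 182]) — not typed in the tree.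

## References

* [Li1992] J.-S. Li, *Non-vanishing theorems for the cohomology of certain arithmetic quotients*, J. reine angew.
  Math. 428 (1992) 177–217, p. 181 (the contragredient `ω*` is `ω_{ψ̄}`), (10)–(15) pp. 181–182.
* [MoeglinVignerasWaldspurger1987] C. Mœglin, M.-F. Vignéras, J.-L. Waldspurger, *Correspondances de Howe sur un
  corps p-adique*, LNM 1291 (1987), Chap. 2 I.1–I.4, II.1 (A)–(B).
* [Weil1964] A. Weil, *Sur certains groupes d'opérateurs unitaires*, Acta Math. 111 (1964) 143–211, Chap. I n° 4
  p. 149, n° 5 pp. 150–151, Chap. III n° 41 Thm 6 p. 193.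
* [GelbartRogawski1991] S. Gelbart, J. Rogawski, *L-functions and Fourier–Jacobi coefficients for the unitary group
  U(3)*, Invent. math. 105 (1991) 445–472, §3.1 p. 454.
-/

set_option autoImplicit false

noncomputable section

namespace Literature.NumberTheory.Weil1964

open Literature.RepresentationTheory.HeisenbergGroup
open Literature.GroupTheory.TwistedProduct (fixer mem_fixer_iff)
open Literature.NumberTheory.Automorphic
open NumberField
open scoped Matrix ComplexConjugate Classical

/-! ## §1 Generic: negating the form, and semilinear transport of structure for `MpPsi` -/

section NegForm

variable {R : Type*} [CommRing R] {V : Type*} [AddCommGroup V] [Module R V]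
  (B B' : V →ₗ[R] V →ₗ[R] R) (hB : ∀ v w, B' v w = -B v w)

/-- **Negating the form**: `(v, t) ↦ (v, −t)` is an isomorphism `Heisenberg B ≃* Heisenberg B′` when `B′ = −B`
(the law `(v,t)(v′,t′) = (v + v′, t + t′ + B v v′)` is carried to the law of `B′ = −B`).
[cite: MoeglinVignerasWaldspurger1987, Chap. 2 I.1] -/
def heisenbergNegCenter : Heisenberg B ≃* Heisenberg B' where
  toFun h := ⟨h.v, -h.t⟩
  invFun h := ⟨h.v, -h.t⟩
  left_inv h := Heisenberg.ext rfl (neg_neg h.t)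
  right_inv h := Heisenberg.ext rfl (neg_neg h.t)
  map_mul' h h' := Heisenberg.ext rfl (by simp only [Heisenberg.mul_t, hB]; ring)

/-- vector component. [folklore] -/
@[simp] theorem heisenbergNegCenter_v (h : Heisenberg B) : (heisenbergNegCenter B B' hB h).v = h.v := rfl

/-- central component. [folklore] -/
@[simp] theorem heisenbergNegCenter_t (h : Heisenberg B) : (heisenbergNegCenter B B' hB h).t = -h.t := rfl

/-- vector component of the inverse. [folklore] -/
@[simp] theorem heisenbergNegCenter_symm_v (h : Heisenberg B') : ((heisenbergNegCenter B B' hB).symm h).v = h.v := rfl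

/-- central component of the inverse. [folklore] -/
@[simp] theorem heisenbergNegCenter_symm_t (h : Heisenberg B') : ((heisenbergNegCenter B B' hB).symm h).t = -h.t :=
  rfl

include hB in
/-- `Sp(alt B′) = Sp(alt B)` inside `GL(V)` when `B′ = −B` (`alt B′ = −alt B`). [cite: Weil1964, Chap. I n° 5 p. 150] -/
theorem mem_symplecticGroup_neg_iff (g : V ≃ₗ[R] V) : g ∈ symplecticGroup B' ↔ g ∈ symplecticGroup B := by
  simp only [mem_symplecticGroup, hB]
  constructor
  · intro h w w'
    have := h w w'
    linear_combination -this
  · intro h w w'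
    have := h w w'
    linear_combination -this

/-- **`Sp(alt B) ≃* Sp(alt B′)`, the identity on `GL(V)`**, when `B′ = −B`. [cite: Weil1964, Chap. I n° 5 p. 150] -/
def symplecticGroupNeg : symplecticGroup B ≃* symplecticGroup B' where
  toFun g := ⟨g.1, (mem_symplecticGroup_neg_iff B B' hB g.1).2 g.2⟩
  invFun g := ⟨g.1, (mem_symplecticGroup_neg_iff B B' hB g.1).1 g.2⟩
  left_inv _ := rfl
  right_inv _ := rfl
  map_mul' _ _ := rfl

/-- underlying linear automorphism: unchanged. [folklore] -/
@[simp] theorem coe_symplecticGroupNeg (g : symplecticGroup B) :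
    ((symplecticGroupNeg B B' hB g : symplecticGroup B') : V ≃ₗ[R] V) = (g : V ≃ₗ[R] V) := rfl

/-- underlying linear automorphism of the inverse: unchanged. [folklore] -/
@[simp] theorem coe_symplecticGroupNeg_symm (g : symplecticGroup B') :
    (((symplecticGroupNeg B B' hB).symm g : symplecticGroup B) : V ≃ₗ[R] V) = (g : V ≃ₗ[R] V) := rfl

variable [Invertible (2 : R)]

/-- **Compatibility with Weil's section** `g ↦ (g, f_g)`, `f_g(w) = ½(B(gw, gw) − B(w, w))`:
`ν((g, f_g^B) · h) = (g, f_g^{B′}) · ν h` for `ν = heisenbergNegCenter` (`f^{B′} = −f^{B}`).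
[cite: Weil1964, Chap. I n° 5 pp. 150–151] -/
theorem heisenbergNegCenter_act (g : symplecticGroup B) (h : Heisenberg B) :
    heisenbergNegCenter B B' hB ((ofSymplectic B g).act h) =
      (ofSymplectic B' (symplecticGroupNeg B B' hB g)).act (heisenbergNegCenter B B' hB h) := by
  refine Heisenberg.ext rfl ?_
  simp only [heisenbergNegCenter_t, Heisenberg.PseudoSymplectic.act_t, ofSymplectic_f, hB, heisenbergNegCenter_v,
    coe_symplecticGroupNeg]
  ring

end NegForm

section SemilinearTransport

variable {R : Type*} [CommRing R] [Invertible (2 : R)] {V : Type*} [AddCommGroup V] [Module R V]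
  {V' : Type*} [AddCommGroup V'] [Module R V'] {B : V →ₗ[R] V →ₗ[R] R} {B' : V' →ₗ[R] V' →ₗ[R] R}
variable (ν : Heisenberg B ≃* Heisenberg B') (e : symplecticGroup B ≃* symplecticGroup B')
  (hν : ∀ (g : symplecticGroup B) (h : Heisenberg B), ν ((ofSymplectic B g).act h) = (ofSymplectic B' (e g)).act (ν h))

include hν in
/-- the section-compatibility for the inverse isomorphisms. [folklore] -/
theorem act_compat_symm (g : symplecticGroup B') (h : Heisenberg B') :
    ν.symm ((ofSymplectic B' g).act h) = (ofSymplectic B (e.symm g)).act (ν.symm h) := by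
  rw [MulEquiv.symm_apply_eq, hν, MulEquiv.apply_symm_apply, MulEquiv.apply_symm_apply]

variable {k : Type*} [CommRing k] {σ σ' : k →+* k} [RingHomInvPair σ σ'] [RingHomInvPair σ' σ]
  {S : Type*} [AddCommGroup S] [Module k S] {S' : Type*} [AddCommGroup S'] [Module k S']
variable (ρ : Representation k (Heisenberg B) S) (ρ' : Representation k (Heisenberg B') S')
variable (A : S ≃ₛₗ[σ] S') (hA : ∀ (h : Heisenberg B) (f : S), A (ρ h f) = ρ' (ν h) (A f))

omit [Invertible (2 : R)] in
include hA in
/-- the intertwining relation for the inverse operator: `A⁻¹ ρ′(h′) = ρ(ν⁻¹ h′) A⁻¹`. [folklore] -/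
theorem slIntertwine_symm (h : Heisenberg B') (f : S') : A.symm (ρ' h f) = ρ (ν.symm h) (A.symm f) := by
  rw [LinearEquiv.symm_apply_eq, hA, MulEquiv.apply_symm_apply, LinearEquiv.apply_symm_apply]

/-- the `σ`-SEMILINEAR CONJUGATE `A M A⁻¹ ∈ GL_k(S′)` of `M ∈ GL_k(S)` (a `k`-LINEAR automorphism again, since
`σ′ ∘ σ = id`). [folklore] -/
def slConj (M : S ≃ₗ[k] S) : S' ≃ₗ[k] S' := A.symm.trans (M.trans A)

/-- formula `(A M A⁻¹) f = A (M (A⁻¹ f))`. [folklore] -/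
@[simp] theorem slConj_apply (M : S ≃ₗ[k] S) (f : S') : slConj A M f = A (M (A.symm f)) := rfl

/-- `A 1 A⁻¹ = 1`. [folklore] -/
@[simp] theorem slConj_one : slConj A (1 : S ≃ₗ[k] S) = 1 :=
  LinearEquiv.ext fun f => by simp [slConj_apply]

/-- `A (M N) A⁻¹ = (A M A⁻¹)(A N A⁻¹)`. [folklore] -/
@[simp] theorem slConj_mul (M N : S ≃ₗ[k] S) : slConj A (M * N) = slConj A M * slConj A N :=
  LinearEquiv.ext fun f => by simp [slConj_apply, LinearEquiv.mul_apply]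

/-- `A⁻¹ (A M A⁻¹) A = M`. [folklore] -/
@[simp] theorem slConj_symm_slConj (M : S ≃ₗ[k] S) : slConj A.symm (slConj A M) = M :=
  LinearEquiv.ext fun f => by simp [slConj_apply]

/-- `A (A⁻¹ M′ A) A⁻¹ = M′`. [folklore] -/
@[simp] theorem slConj_slConj_symm (M' : S' ≃ₗ[k] S') : slConj A (slConj A.symm M') = M' :=
  LinearEquiv.ext fun f => by simp [slConj_apply]

include hν hA in
/-- **Semilinear transport preserves condition (A)**: if `(g, M) ∈ Mp_ψ(W)` for `ρ` then `(e g, A M A⁻¹) ∈ Mp_ψ(W′)`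
for `ρ′`. [cite: MoeglinVignerasWaldspurger1987, Chap. 2 II.1 (A)] -/
theorem MpPsi.slTransport_mem (p : MpPsi ρ) : (e (MpPsi.proj ρ p), slConj A (MpPsi.toOp ρ p)) ∈ MpPsi ρ' := by
  rw [mem_MpPsi]
  intro h f
  have hp := (mem_MpPsi ρ _).1 p.2 (ν.symm h) (A.symm f)
  simp only [slConj_apply, MpPsi.proj_apply, MpPsi.toOp_apply]
  rw [slIntertwine_symm ν ρ ρ' A hA, hp, hA, hν, MulEquiv.apply_symm_apply]

/-- the semilinear transport as a monoid homomorphism `Mp_ψ(W) →* Mp_ψ(W′)`.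
[cite: MoeglinVignerasWaldspurger1987, Chap. 2 II.1 (B)] -/
def MpPsi.slTransportHom : MpPsi ρ →* MpPsi ρ' where
  toFun p := ⟨_, MpPsi.slTransport_mem ν e hν ρ ρ' A hA p⟩
  map_one' := by
    refine Subtype.ext (Prod.ext ?_ ?_)
    · show e (MpPsi.proj ρ 1) = 1
      rw [map_one, map_one]
    · show slConj A (MpPsi.toOp ρ 1) = 1
      rw [map_one, slConj_one]
  map_mul' p q := by
    refine Subtype.ext (Prod.ext ?_ ?_)
    · show e (MpPsi.proj ρ (p * q)) = e (MpPsi.proj ρ p) * e (MpPsi.proj ρ q)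
      rw [map_mul, map_mul]
    · show slConj A (MpPsi.toOp ρ (p * q)) = slConj A (MpPsi.toOp ρ p) * slConj A (MpPsi.toOp ρ q)
      rw [map_mul, slConj_mul]

/-- formula for the transport homomorphism. [folklore] -/
@[simp] theorem MpPsi.coe_slTransportHom (p : MpPsi ρ) :
    ((MpPsi.slTransportHom ν e hν ρ ρ' A hA p : MpPsi ρ') : symplecticGroup B' × (S' ≃ₗ[k] S')) =
      (e (MpPsi.proj ρ p), slConj A (MpPsi.toOp ρ p)) :=
  rfl

/-- **SEMILINEAR TRANSPORT OF STRUCTURE `Mp_ψ(W) ≃* Mp_ψ(W′)`** along `(ν, e, A)`: `(g, M) ↦ (e g, A M A⁻¹)`, inverse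
the transport along `(ν⁻¹, e⁻¹, A⁻¹)`. [cite: MoeglinVignerasWaldspurger1987, Chap. 2 II.1 (A)–(B)] -/
def MpPsi.slTransport : MpPsi ρ ≃* MpPsi ρ' :=
  (MpPsi.slTransportHom ν e hν ρ ρ' A hA).toMulEquiv
    (MpPsi.slTransportHom ν.symm e.symm (act_compat_symm ν e hν) ρ' ρ A.symm (slIntertwine_symm ν ρ ρ' A hA))
    (MonoidHom.ext fun p => Subtype.ext <| Prod.ext (e.symm_apply_apply _)
      (by simp only [MonoidHom.comp_apply, MpPsi.coe_slTransportHom, MpPsi.toOp_apply, MonoidHom.id_apply,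
            slConj_symm_slConj]))
    (MonoidHom.ext fun p => Subtype.ext <| Prod.ext (e.apply_symm_apply _)
      (by simp only [MonoidHom.comp_apply, MpPsi.coe_slTransportHom, MpPsi.toOp_apply, MonoidHom.id_apply,
            slConj_slConj_symm]))

/-- formula for the transport. [folklore] -/
@[simp] theorem MpPsi.coe_slTransport (p : MpPsi ρ) :
    ((MpPsi.slTransport ν e hν ρ ρ' A hA p : MpPsi ρ') : symplecticGroup B' × (S' ≃ₗ[k] S')) =
      (e (MpPsi.proj ρ p), slConj A (MpPsi.toOp ρ p)) :=
  rfl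

/-- formula for the inverse transport. [folklore] -/
@[simp] theorem MpPsi.coe_slTransport_symm (q : MpPsi ρ') :
    (((MpPsi.slTransport ν e hν ρ ρ' A hA).symm q : MpPsi ρ) : symplecticGroup B × (S ≃ₗ[k] S)) =
      (e.symm (MpPsi.proj ρ' q), slConj A.symm (MpPsi.toOp ρ' q)) :=
  rfl

/-- **`π ∘ transport = e ∘ π`**. [cite: MoeglinVignerasWaldspurger1987, Chap. 2 II.1 (B)] -/
@[simp] theorem MpPsi.proj_slTransport (p : MpPsi ρ) :
    MpPsi.proj ρ' (MpPsi.slTransport ν e hν ρ ρ' A hA p) = e (MpPsi.proj ρ p) :=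
  rfl

/-- **the transported operator is `A M A⁻¹`**. [cite: MoeglinVignerasWaldspurger1987, Chap. 2 II.1 (B)] -/
@[simp] theorem MpPsi.toOp_slTransport (p : MpPsi ρ) :
    MpPsi.toOp ρ' (MpPsi.slTransport ν e hν ρ ρ' A hA p) = slConj A (MpPsi.toOp ρ p) :=
  rfl

/-- pointwise: `toOp (transport p) f = A (toOp p (A⁻¹ f))`. [folklore] -/
theorem MpPsi.toOp_slTransport_apply (p : MpPsi ρ) (f : S') :
    MpPsi.toOp ρ' (MpPsi.slTransport ν e hν ρ ρ' A hA p) f = A (MpPsi.toOp ρ p (A.symm f)) :=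
  rfl

/-- **the Weil representation is transported by `A`**: `ω_ψ(transport p) f = A (ω_ψ(p) (A⁻¹ f))`.
[cite: GelbartRogawski1991, §3.1 p. 454] -/
theorem omegaPsi_slTransport_apply (p : MpPsi ρ) (f : S') :
    omegaPsi ρ' (MpPsi.slTransport ν e hν ρ ρ' A hA p) f = A (omegaPsi ρ p (A.symm f)) :=
  rfl

variable {X X' : Type*} (Θ : S → X) (Θ' : S' → X') (τ : X → X') (hτ : Function.Injective τ)
  (hΘ : ∀ f, Θ' (A f) = τ (Θ f))

include hτ hΘ in
/-- **Transport preserves `Θ`-fixing** when `Θ′ ∘ A = τ ∘ Θ` with `τ` injective (for complex conjugation: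
`Θ(Φ̄) = conj Θ(Φ)`): `transport p` fixes `Θ′` iff `p` fixes `Θ`. [cite: Weil1964, Chap. III n° 41 Thm 6 p. 193] -/
theorem MpPsi.slTransport_mem_fixing_iff (p : MpPsi ρ) :
    MpPsi.slTransport ν e hν ρ ρ' A hA p ∈ MpPsi.fixing ρ' Θ' ↔ p ∈ MpPsi.fixing ρ Θ := by
  rw [MpPsi.mem_fixing_iff, MpPsi.mem_fixing_iff]
  constructor
  · intro H f
    have h1 := H (A f)
    change Θ' (A ((p : symplecticGroup B × (S ≃ₗ[k] S)).2 (A.symm (A f)))) = Θ' (A f) at h1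
    rw [LinearEquiv.symm_apply_apply, hΘ, hΘ] at h1
    exact hτ h1
  · intro H f
    change Θ' (A ((p : symplecticGroup B × (S ≃ₗ[k] S)).2 (A.symm f))) = Θ' f
    rw [hΘ, H, ← hΘ, LinearEquiv.apply_symm_apply]

end SemilinearTransport

/-! ## §2 Complex conjugation on `𝒮(𝔸_F^ι)` and on the theta distribution -/

section ConjSchwartzBruhat

variable (F : Type) [Field F] [NumberField F] (ι : Type) [Fintype ι]

variable {F ι} in
/-- a factorizable Schwartz–Bruhat function has a factorizable complex conjugate: `Φ̄ = Φ̄_∞ ⊗ Φ̄_f`, with `Φ̄_∞`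
Schwartz (postcomposition with the real-linear isometry `conj`, Mathlib `SchwartzMap.postcompCLM`) and `Φ̄_f`
locally constant of compact support. [folklore] -/
theorem isFactorizablePiSchwartzBruhat_star {Φ : (ι → AdeleRing (𝓞 F) F) → ℂ}
    (h : IsFactorizablePiSchwartzBruhat F ι Φ) : IsFactorizablePiSchwartzBruhat F ι (star Φ) := by
  obtain ⟨Φinf, Φfin, hfin, rfl⟩ := h
  refine ⟨SchwartzMap.postcompCLM (𝕜 := ℝ) (Complex.conjCLE : ℂ →L[ℝ] ℂ) Φinf, star Φfin, ?_, ?_⟩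
  · rw [mem_schwartzBruhat_iff] at hfin ⊢
    exact ⟨hfin.1.comp (star : ℂ → ℂ), hfin.2.comp_left (g := (star : ℂ → ℂ)) (star_zero ℂ)⟩
  · funext v
    change star (Φinf (piArch F ι v) * Φfin (piFinite F ι v)) = conj (Φinf (piArch F ι v)) * star (Φfin (piFinite F ι v))
    rw [star_mul', Complex.star_def]

variable {F ι} in
/-- **`𝒮(𝔸_F^ι)` is closed under complex conjugation.** [folklore] -/
theorem star_mem_piSchwartzBruhat {Φ : (ι → AdeleRing (𝓞 F) F) → ℂ} (hΦ : Φ ∈ piSchwartzBruhat F ι) :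
    star Φ ∈ piSchwartzBruhat F ι := by
  induction hΦ using Submodule.span_induction with
  | mem Φ h => exact mem_piSchwartzBruhat (isFactorizablePiSchwartzBruhat_star h)
  | zero =>
    rw [star_zero]
    exact zero_mem _
  | add Φ Ψ _ _ ihΦ ihΨ =>
    rw [star_add]
    exact add_mem ihΦ ihΨ
  | smul c Φ _ ih =>
    rw [star_smul]
    exact Submodule.smul_mem _ (star c) ih

/-- **COMPLEX CONJUGATION `C : 𝒮(𝔸_F^ι) → 𝒮(𝔸_F^ι)`, `Φ ↦ Φ̄`**, a conjugate-linear involution.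
[folklore] -/
def piSchwartzBruhatConj : piSchwartzBruhat F ι ≃ₛₗ[starRingEnd ℂ] piSchwartzBruhat F ι where
  toFun Φ := ⟨star (Φ : (ι → AdeleRing (𝓞 F) F) → ℂ), star_mem_piSchwartzBruhat Φ.2⟩
  invFun Φ := ⟨star (Φ : (ι → AdeleRing (𝓞 F) F) → ℂ), star_mem_piSchwartzBruhat Φ.2⟩
  map_add' Φ Ψ := Subtype.ext (star_add _ _)
  map_smul' c Φ := Subtype.ext (by
    change star (c • (Φ : (ι → AdeleRing (𝓞 F) F) → ℂ)) = (starRingEnd ℂ c) • star (Φ : (ι → AdeleRing (𝓞 F) F) → ℂ)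
    rw [star_smul, starRingEnd_apply])
  left_inv Φ := Subtype.ext (star_star _)
  right_inv Φ := Subtype.ext (star_star _)

variable {F ι}

/-- underlying function: `(C Φ) = star Φ`, i.e. `(C Φ)(u) = conj (Φ u)`. [folklore] -/
@[simp] theorem coe_piSchwartzBruhatConj (Φ : piSchwartzBruhat F ι) :
    ((piSchwartzBruhatConj F ι Φ : piSchwartzBruhat F ι) : (ι → AdeleRing (𝓞 F) F) → ℂ) =
      star (Φ : (ι → AdeleRing (𝓞 F) F) → ℂ) := rfl

/-- pointwise formula. [folklore] -/
theorem piSchwartzBruhatConj_apply (Φ : piSchwartzBruhat F ι) (u : ι → AdeleRing (𝓞 F) F) :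
    ((piSchwartzBruhatConj F ι Φ : piSchwartzBruhat F ι) : (ι → AdeleRing (𝓞 F) F) → ℂ) u =
      conj ((Φ : (ι → AdeleRing (𝓞 F) F) → ℂ) u) := rfl

/-- `C` is an involution: `C⁻¹ = C`. [folklore] -/
@[simp] theorem piSchwartzBruhatConj_symm : (piSchwartzBruhatConj F ι).symm = piSchwartzBruhatConj F ι := rfl

/-- `C (C Φ) = Φ`. [folklore] -/
@[simp] theorem piSchwartzBruhatConj_piSchwartzBruhatConj (Φ : piSchwartzBruhat F ι) :
    piSchwartzBruhatConj F ι (piSchwartzBruhatConj F ι Φ) = Φ := Subtype.ext (star_star _)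

omit [Fintype ι] in
/-- **`Θ(Φ̄) = conj Θ(Φ)`** for the theta distribution `Θ(Φ) = Σ_{ξ ∈ F^ι} Φ(ξ)` (conjugation is continuous, Mathlib
`Complex.conj_tsum`). [cite: Weil1964, Chap. III n° 41 Thm 6 p. 193] -/
theorem thetaDist_star (Φ : (ι → AdeleRing (𝓞 F) F) → ℂ) : thetaDist F ι (star Φ) = conj (thetaDist F ι Φ) := by
  rw [thetaDist_def, thetaDist_def, Complex.conj_tsum]
  rfl

/-- the same on `𝒮(𝔸_F^ι)`: `Θ (C Φ) = conj (Θ Φ)`. [cite: Weil1964, Chap. III n° 41 Thm 6 p. 193] -/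
theorem thetaDistLM_piSchwartzBruhatConj (Φ : piSchwartzBruhat F ι) :
    thetaDistLM F ι (piSchwartzBruhatConj F ι Φ) = conj (thetaDistLM F ι Φ) := by
  rw [thetaDistLM_apply, thetaDistLM_apply, coe_piSchwartzBruhatConj, thetaDist_star]

end ConjSchwartzBruhat

/-! ## §3 The conjugate model: `Mp_ψ(W_T) ≃* Mp_ψ(W_{−T})`, `(g, M) ↦ (g, C M C)` -/

section Adelic

variable (F : Type) [Field F] [NumberField F] (ι : Type) [Fintype ι] [DecidableEq ι]
variable (T : Matrix ι ι (AdeleRing (𝓞 F) F))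

/-- `β_{−T} = −β_T` on `W_𝔸 = 𝔸_F^ι × 𝔸_F^ι` (the space `W⁻` with the negated form). [folklore] -/
theorem polar_adelicForm_neg (v w : (ι → AdeleRing (𝓞 F) F) × (ι → AdeleRing (𝓞 F) F)) :
    polar (adelicForm F ι (-T)) v w = -polar (adelicForm F ι T) v w := by
  rw [polar_apply, polar_apply, adelicForm_apply, adelicForm_apply, Matrix.neg_mulVec, dotProduct_neg]

/-- `ν : H(W_T) ≃* H(W_{−T})`, `(w, t) ↦ (w, −t)`. [cite: MoeglinVignerasWaldspurger1987, Chap. 2 I.1] -/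
abbrev adelicHeisenbergNeg : AdelicHeisenberg F ι T ≃* AdelicHeisenberg F ι (-T) :=
  heisenbergNegCenter (polar (adelicForm F ι T)) (polar (adelicForm F ι (-T))) (polar_adelicForm_neg F ι T)

/-- `Sp(W_T)(𝔸) ≃* Sp(W_{−T})(𝔸)`, the identity on `GL(W_𝔸)`. [cite: Weil1964, Chap. I n° 5 p. 150] -/
abbrev adelicSymplecticNeg :
    symplecticGroup (polar (adelicForm F ι T)) ≃* symplecticGroup (polar (adelicForm F ι (-T))) :=
  symplecticGroupNeg (polar (adelicForm F ι T)) (polar (adelicForm F ι (-T))) (polar_adelicForm_neg F ι T)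

variable {F ι T} in
/-- **THE CONJUGATE MODEL**: `conj (ρ_T(h) Φ) = ρ_{−T}(ν h) Φ̄`, i.e.
`conj (ψ_F(t + ⟨u, T y⟩) Φ(u + x)) = ψ_F(−t + ⟨u, (−T) y⟩) conj Φ(u + x)` (`conj ψ_F(a) = ψ_F(−a)`).
[cite: Li1992, p. 181] -/
theorem adelicSchrodinger_conj (h : AdelicHeisenberg F ι T) (Φ : piSchwartzBruhat F ι) :
    piSchwartzBruhatConj F ι (adelicSchrodinger F ι T h Φ) =
      adelicSchrodinger F ι (-T) (adelicHeisenbergNeg F ι T h) (piSchwartzBruhatConj F ι Φ) := by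
  refine Subtype.ext (funext fun u => ?_)
  have h1 : (adelicHeisenbergNeg F ι T h).t + u ⬝ᵥ ((-T) *ᵥ (adelicHeisenbergNeg F ι T h).v.2) =
      -(h.t + u ⬝ᵥ (T *ᵥ h.v.2)) := by
    rw [heisenbergNegCenter_t, heisenbergNegCenter_v, Matrix.neg_mulVec, dotProduct_neg, neg_add]
  have h2 : ((piSchwartzBruhatConj F ι Φ : piSchwartzBruhat F ι) : (ι → AdeleRing (𝓞 F) F) → ℂ)
      (u + (adelicHeisenbergNeg F ι T h).v.1) = conj ((Φ : (ι → AdeleRing (𝓞 F) F) → ℂ) (u + h.v.1)) := rfl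
  rw [piSchwartzBruhatConj_apply, adelicSchrodinger_apply, adelicSchrodinger_apply, map_mul,
    ← Circle.coe_inv_eq_conj, ← AddChar.map_neg_eq_inv, h1, h2]

/-- **`Mp_ψ(W_T) ≃* Mp_ψ(W_{−T})`, `(g, M) ↦ (g, C M C)`** — the Weil representation of `W⁻ = (W, −⟨·,·⟩)` is the
COMPLEX CONJUGATE of the Weil representation of `W`, realised on the same space `𝒮(𝔸_F^ι)` by conjugating the
operators; it covers the identity `Sp(W_T) = Sp(W_{−T}) ≤ GL(W_𝔸)`.
[cite: Li1992, p. 181; MoeglinVignerasWaldspurger1987, Chap. 2 II.1 (A)–(B)] -/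
def adelicMpConj : adelicMp F ι T ≃* adelicMp F ι (-T) :=
  MpPsi.slTransport (adelicHeisenbergNeg F ι T) (adelicSymplecticNeg F ι T)
    (heisenbergNegCenter_act _ _ (polar_adelicForm_neg F ι T)) (adelicSchrodinger F ι T) (adelicSchrodinger F ι (-T))
    (piSchwartzBruhatConj F ι) adelicSchrodinger_conj

variable {F ι T}

/-- **`π(pᶜ) = π(p)`**: the conjugate pair lies over the same symplectic automorphism (as an element of
`Sp(W_{−T})(𝔸)` through the identity identification). [cite: MoeglinVignerasWaldspurger1987, Chap. 2 II.1 (B)] -/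
theorem proj_adelicMpConj (p : adelicMp F ι T) :
    MpPsi.proj (adelicSchrodinger F ι (-T)) (adelicMpConj F ι T p) =
      adelicSymplecticNeg F ι T (MpPsi.proj (adelicSchrodinger F ι T) p) :=
  MpPsi.proj_slTransport _ _ _ _ _ _ _ p

/-- **`π(pᶜ) = π(p)` in `GL(W_𝔸)`**. [cite: MoeglinVignerasWaldspurger1987, Chap. 2 II.1 (B)] -/
@[simp] theorem coe_proj_adelicMpConj (p : adelicMp F ι T) :
    ((MpPsi.proj (adelicSchrodinger F ι (-T)) (adelicMpConj F ι T p) : symplecticGroup (polar (adelicForm F ι (-T)))) :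
        ((ι → AdeleRing (𝓞 F) F) × (ι → AdeleRing (𝓞 F) F)) ≃ₗ[AdeleRing (𝓞 F) F]
          ((ι → AdeleRing (𝓞 F) F) × (ι → AdeleRing (𝓞 F) F))) =
      (MpPsi.proj (adelicSchrodinger F ι T) p : symplecticGroup (polar (adelicForm F ι T))) := by
  rw [proj_adelicMpConj]
  exact coe_symplecticGroupNeg _ _ _ _

/-- the same for the inverse. [folklore] -/
theorem proj_adelicMpConj_symm (q : adelicMp F ι (-T)) :
    MpPsi.proj (adelicSchrodinger F ι T) ((adelicMpConj F ι T).symm q) =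
      (adelicSymplecticNeg F ι T).symm (MpPsi.proj (adelicSchrodinger F ι (-T)) q) :=
  congrArg Prod.fst (MpPsi.coe_slTransport_symm (adelicHeisenbergNeg F ι T) (adelicSymplecticNeg F ι T)
    (heisenbergNegCenter_act _ _ (polar_adelicForm_neg F ι T)) (adelicSchrodinger F ι T) (adelicSchrodinger F ι (-T))
    (piSchwartzBruhatConj F ι) adelicSchrodinger_conj q)

/-- the same for the inverse, in `GL(W_𝔸)`. [folklore] -/
@[simp] theorem coe_proj_adelicMpConj_symm (q : adelicMp F ι (-T)) :
    ((MpPsi.proj (adelicSchrodinger F ι T) ((adelicMpConj F ι T).symm q) : symplecticGroup (polar (adelicForm F ι T))) :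
        ((ι → AdeleRing (𝓞 F) F) × (ι → AdeleRing (𝓞 F) F)) ≃ₗ[AdeleRing (𝓞 F) F]
          ((ι → AdeleRing (𝓞 F) F) × (ι → AdeleRing (𝓞 F) F))) =
      (MpPsi.proj (adelicSchrodinger F ι (-T)) q : symplecticGroup (polar (adelicForm F ι (-T)))) := by
  rw [proj_adelicMpConj_symm]
  exact coe_symplecticGroupNeg_symm _ _ _ _

/-- **`ω_{−T}(pᶜ) = C ω_T(p) C`**: the operator of the conjugate pair. [cite: Li1992, p. 181] -/
theorem toOp_adelicMpConj (p : adelicMp F ι T) :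
    MpPsi.toOp (adelicSchrodinger F ι (-T)) (adelicMpConj F ι T p) =
      slConj (piSchwartzBruhatConj F ι) (MpPsi.toOp (adelicSchrodinger F ι T) p) :=
  MpPsi.toOp_slTransport _ _ _ _ _ _ _ p

/-- pointwise: **`ω_{−T}(pᶜ) Ψ = conj (ω_T(p) Ψ̄)`**. [cite: Li1992, p. 181] -/
theorem toOp_adelicMpConj_apply (p : adelicMp F ι T) (Ψ : piSchwartzBruhat F ι) :
    MpPsi.toOp (adelicSchrodinger F ι (-T)) (adelicMpConj F ι T p) Ψ =
      piSchwartzBruhatConj F ι (MpPsi.toOp (adelicSchrodinger F ι T) p (piSchwartzBruhatConj F ι Ψ)) :=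
  MpPsi.toOp_slTransport_apply _ _ _ _ _ _ _ p Ψ

/-- the same for GR91's `ω_ψ`: `ω_ψ^{−T}(pᶜ) Ψ = C (ω_ψ^{T}(p) (C Ψ))`. [cite: GelbartRogawski1991, §3.1 p. 454] -/
theorem omegaPsi_adelicMpConj_apply (p : adelicMp F ι T) (Ψ : piSchwartzBruhat F ι) :
    omegaPsi (adelicSchrodinger F ι (-T)) (adelicMpConj F ι T p) Ψ =
      piSchwartzBruhatConj F ι (omegaPsi (adelicSchrodinger F ι T) p (piSchwartzBruhatConj F ι Ψ)) :=
  omegaPsi_slTransport_apply _ _ _ _ _ _ _ p Ψ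

/-- the inverse: `ω_T(qᶜ⁻¹) Φ = conj (ω_{−T}(q) Φ̄)`. [cite: Li1992, p. 181] -/
theorem toOp_adelicMpConj_symm_apply (q : adelicMp F ι (-T)) (Φ : piSchwartzBruhat F ι) :
    MpPsi.toOp (adelicSchrodinger F ι T) ((adelicMpConj F ι T).symm q) Φ =
      piSchwartzBruhatConj F ι (MpPsi.toOp (adelicSchrodinger F ι (-T)) q (piSchwartzBruhatConj F ι Φ)) := by
  have h := congrArg Prod.snd (MpPsi.coe_slTransport_symm (adelicHeisenbergNeg F ι T) (adelicSymplecticNeg F ι T)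
    (heisenbergNegCenter_act _ _ (polar_adelicForm_neg F ι T)) (adelicSchrodinger F ι T) (adelicSchrodinger F ι (-T))
    (piSchwartzBruhatConj F ι) adelicSchrodinger_conj q)
  rw [← MpPsi.toOp_apply] at h
  change MpPsi.toOp (adelicSchrodinger F ι T) ((adelicMpConj F ι T).symm q) =
    slConj (piSchwartzBruhatConj F ι).symm (MpPsi.toOp (adelicSchrodinger F ι (-T)) q) at h
  rw [h, slConj_apply, piSchwartzBruhatConj_symm, piSchwartzBruhatConj_symm]

/-- **`Θ`-fixing is preserved**: `pᶜ ∈ Mp_ψ(W_{−T})^Θ ↔ p ∈ Mp_ψ(W_T)^Θ` (`Θ(Φ̄) = conj Θ(Φ)`, `conj` injective).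
[cite: Weil1964, Chap. III n° 41 Thm 6 p. 193] -/
theorem adelicMpConj_mem_adelicMpTheta_iff (p : adelicMp F ι T) :
    adelicMpConj F ι T p ∈ adelicMpTheta F ι (-T) ↔ p ∈ adelicMpTheta F ι T :=
  MpPsi.slTransport_mem_fixing_iff _ _ _ _ _ _ _ (thetaDistLM F ι : piSchwartzBruhat F ι → ℂ)
    (thetaDistLM F ι : piSchwartzBruhat F ι → ℂ) (starRingEnd ℂ) (RingHom.injective _)
    thetaDistLM_piSchwartzBruhatConj p

/-- **THETA-KERNEL CONJUGATION FORMULA**: `Θ(ω_{−T}(pᶜ) Φ̄) = conj Θ(ω_T(p) Φ)` — the conjugate `θ̄_Φ(p)` of the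
theta kernel of `Φ` is the theta kernel of `Φ̄` on `W⁻`, evaluated at the conjugate pair.
[cite: Li1992, (11)–(15) pp. 181–182] -/
theorem thetaDist_toOp_adelicMpConj (p : adelicMp F ι T) (Φ : piSchwartzBruhat F ι) :
    thetaDist F ι (MpPsi.toOp (adelicSchrodinger F ι (-T)) (adelicMpConj F ι T p) (piSchwartzBruhatConj F ι Φ) :
        (ι → AdeleRing (𝓞 F) F) → ℂ) =
      conj (thetaDist F ι (MpPsi.toOp (adelicSchrodinger F ι T) p Φ : (ι → AdeleRing (𝓞 F) F) → ℂ)) := by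
  rw [toOp_adelicMpConj_apply, piSchwartzBruhatConj_piSchwartzBruhatConj, coe_piSchwartzBruhatConj, thetaDist_star]

/-- the same composed with the Heisenberg action (the full theta kernel `(p, h) ↦ Θ(ω(p) ρ(h) Φ)`):
`Θ(ω_{−T}(pᶜ) ρ_{−T}(ν h) Φ̄) = conj Θ(ω_T(p) ρ_T(h) Φ)`. [cite: Li1992, (11)–(15) pp. 181–182] -/
theorem thetaDist_toOp_adelicMpConj_adelicSchrodinger (p : adelicMp F ι T) (h : AdelicHeisenberg F ι T)
    (Φ : piSchwartzBruhat F ι) :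
    thetaDist F ι (MpPsi.toOp (adelicSchrodinger F ι (-T)) (adelicMpConj F ι T p)
        (adelicSchrodinger F ι (-T) (adelicHeisenbergNeg F ι T h) (piSchwartzBruhatConj F ι Φ)) :
        (ι → AdeleRing (𝓞 F) F) → ℂ) =
      conj (thetaDist F ι (MpPsi.toOp (adelicSchrodinger F ι T) p (adelicSchrodinger F ι T h Φ) :
        (ι → AdeleRing (𝓞 F) F) → ℂ)) := by
  rw [← adelicSchrodinger_conj, thetaDist_toOp_adelicMpConj]

variable (F ι T) in
/-- **uniqueness transfer**: two pairs of `Mp_ψ(W_{−T})` over the same `g` whose operators both fix `Θ` are equal as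
soon as the same holds over `W_T` — i.e. `Θ`-RIGIDITY passes to the conjugate model (used to identify the
`Θ`-forced rational lift of `W⁻` with the conjugate of that of `W`). [cite: Weil1964, Chap. III n° 41 Thm 6 p. 193] -/
theorem adelicMpConj_eq_iff (p q : adelicMp F ι T) : adelicMpConj F ι T p = adelicMpConj F ι T q ↔ p = q :=
  (adelicMpConj F ι T).injective.eq_iff

end Adelic

end Literature.NumberTheory.Weil1964
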